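import Summits.ResolutionOfSingularities.ResolutionOfSingularities.Theses.PAlteration
import Literature.AlgebraicGeometry.Resolution.NormalizationInExtension
import Literature.AlgebraicGeometry.Resolution.QuasiExcellentSchemes
import Literature.AlgebraicGeometry.Resolution.StrictTransformFlattening
import Literature.AlgebraicGeometry.Resolution.Temkin2008Localization

/-!
# Stub-ideation k=1 (FAMILY 1 — recognise & import) for `stub_picoverDegP` — statement sanity sketch

Helper-lemma SIGNATURES only (sorried); see `STUB-IDEAS-stub_picoverDegP-1.md`.
-/

noncomputable section

open CategoryTheory AlgebraicGeometry TopologicalSpace IsLocalRing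
open Literature.AlgebraicGeometry.Resolution

namespace Summit.ResolutionOfSingularities.ResolutionOfSingularities.Cruxes.Picover.StubIdeas1

universe u

/-- **Local-fibre resolution at a point `x`** (weak-proper form of Temkin 2008 Prop. 2.3.4 (iii);
ideator-1's `LocalFibreResH1` over the tree API): every integral `S'` proper and birational over
`Spec 𝒪_{X,x}` which is regular off the closed fibre has a resolution that is an isomorphism off
the closed fibre. -/
def LocalFibreRes {X : Scheme.{u}} (x : X) : Prop :=
  ∀ (S' : Scheme.{u}) [IsIntegral S'] (g : S' ⟶ Spec (X.presheaf.stalk x)),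
    IsProper g → IsBirational g →
    (∀ s : S', g s ≠ closedPoint (X.presheaf.stalk x) → s ∈ Scheme.regularLocus S') →
    ∃ (S'' : Scheme.{u}) (π : S'' ⟶ S'), IsResolution π ∧
      ∃ U : S'.Opens, (∀ s : S', g s ≠ closedPoint (X.presheaf.stalk x) → s ∈ U) ∧ IsIso (π ∣_ U)

/-- F1 — **weak noetherian localisation** (Temkin 2008 Prop. 2.3.4, garbage-free variant: grow a
proper birational `Ȳ → X` regular over an increasing open; extension at a maximal bad point by
spreading a local-fibre resolution and re-compactifying with Nagata = Stacks 0F41, in tree modulo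
`Stacks081R`). -/
theorem hasResolution_of_localFibreRes (h081R : Stacks081R.{u})
    {X : Scheme.{u}} {k : Type u} [Field k] (f : X ⟶ Spec (.of k)) [IsIntegral X]
    [IsSeparated f] [LocallyOfFiniteType f] [QuasiCompact f]
    (hloc : ∀ x : X, x ∉ Scheme.regularLocus X → LocalFibreRes x) :
    Scheme.HasResolution X := by
  sorry

/-- F2 — **dimension of a proper birational scheme over a local ring essentially of finite type
over a field** (dimension formula, EGA IV 5.6.6 / Stacks 02JU). -/
theorem topologicalKrullDim_le_of_isProper_of_isBirational {k : Type u} [Field k]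
    (R : Type u) [CommRing R] [IsDomain R] [Algebra k R] [Algebra.EssFiniteType k R]
    (S' : Scheme.{u}) [IsIntegral S'] (g : S' ⟶ Spec (.of R)) [IsProper g]
    (hg : IsBirational g) : topologicalKrullDim S' ≤ ringKrullDim R := by
  sorry

/-- F3 — **IMPORT: local-fibre resolution in local dimension `≤ 3`** from Cossart–Piltant 2019
Thm. 1.1 as printed (`CossartPiltant2019General`: resolution iso over `Reg`, for reduced separated
Noetherian quasi-excellent schemes of dimension `≤ 3`), applied to `S'` (quasi-excellent: of
finite type over the quasi-excellent `𝒪_{X,x}`, Stacks 07QU in tree; `dim S' ≤ 3` by F2). -/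
theorem localFibreRes_of_ringKrullDim_le_three (hCP : CossartPiltant2019General.{u})
    {X : Scheme.{u}} {k : Type u} [Field k] (f : X ⟶ Spec (.of k)) [IsIntegral X]
    [IsSeparated f] [LocallyOfFiniteType f] [QuasiCompact f] (x : X)
    (hx : ringKrullDim (X.presheaf.stalk x) ≤ 3) : LocalFibreRes x := by
  sorry

/-- F4 — THE KERNEL (open research content, = CP2019's test case (G)(i) at `dim S ≥ 4`):
local-fibre resolution at the points of local dimension `≥ 4` of degree-`p` purely inseparable
normalizations of regular varieties. For `dim W = 4` these are exactly the singular CLOSED points. -/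
def PicoverKernel (p : ℕ) : Prop :=
  ∀ (k : Type) [Field k] [CharP k p] (W : Scheme.{0}) [IsIntegral W] (f : W ⟶ Spec (.of k))
    (L : Type) [Field L] [Algebra W.functionField L],
    IsSeparated f → LocallyOfFiniteType f → QuasiCompact f → Scheme.IsRegular W →
    IsPurelyInseparable W.functionField L → Module.finrank W.functionField L = p →
    ∀ x : normalizationIn W L, x ∉ Scheme.regularLocus (normalizationIn W L) →
      4 ≤ ringKrullDim ((normalizationIn W L).presheaf.stalk x) → LocalFibreRes x

/-- F5 (all-`n` bonus, "the `∀ k` engine") — **generic-fibre shift**: a non-maximal prime of a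
finite-type domain over a field becomes maximal over the field `k' = k(t)` after inverting
`k[t] ∖ 0`, `t` lifting a transcendence basis of the residue field; dimension drops. -/
theorem exists_isLocalization_isMaximal_of_not_isMaximal (k R : Type u) [Field k] [CommRing R]
    [IsDomain R] [Algebra k R] [Algebra.FiniteType k R] (P : Ideal R) [P.IsPrime]
    (hP : ¬ P.IsMaximal) :
    ∃ (M : Submonoid R) (_ : M ≤ P.primeCompl) (k' : Type u) (_ : Field k')
      (_ : Algebra k' (Localization M)),
      Algebra.FiniteType k' (Localization M) ∧
        (P.map (algebraMap R (Localization M))).IsMaximal ∧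
        ringKrullDim (Localization M) < ringKrullDim R := by
  sorry

/-- ASSEMBLY — the stub at a prime `p`, modulo the two named facts and the kernel. -/
theorem stub_picoverDegP_of_kernel (h081R : Stacks081R.{0}) (hCP : CossartPiltant2019General.{0})
    (p : ℕ) (hp : p.Prime) (hK : PicoverKernel p) :
    ∀ (k : Type) [Field k] [CharP k p] (W : Scheme.{0}) [IsIntegral W] (f : W ⟶ Spec (.of k))
      (L : Type) [Field L] [Algebra W.functionField L], IsSeparated f → LocallyOfFiniteType f →
      QuasiCompact f → Scheme.IsRegular W → IsPurelyInseparable W.functionField L →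
      Module.finrank W.functionField L = p → Scheme.HasResolution (normalizationIn W L) := by
  intro k _ _ W _ f L _ _ hsep hlft hqc hreg hpi hdeg
  haveI : FiniteDimensional W.functionField L :=
    Module.finite_of_finrank_pos (by rw [hdeg]; exact hp.pos)
  haveI : IsSeparated f := hsep
  haveI : LocallyOfFiniteType f := hlft
  haveI : QuasiCompact f := hqc
  haveI : IsFinite (normalizationInι W L) := isFinite_normalizationInι W L f
  haveI : IsSeparated (normalizationInι W L ≫ f) := inferInstance
  haveI : LocallyOfFiniteType (normalizationInι W L ≫ f) := inferInstance
  haveI : QuasiCompact (normalizationInι W L ≫ f) := inferInstance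
  refine hasResolution_of_localFibreRes h081R (normalizationInι W L ≫ f) fun x hx => ?_
  by_cases h4 : 4 ≤ ringKrullDim ((normalizationIn W L).presheaf.stalk x)
  · exact hK k W f L hsep hlft hqc hreg hpi hdeg x hx h4
  · refine localFibreRes_of_ringKrullDim_le_three hCP (normalizationInι W L ≫ f) x ?_
    -- `¬ 4 ≤ d → d ≤ 3` in `WithBot ℕ∞`
    have h := not_le.mp h4
    generalize ringKrullDim ((normalizationIn W L).presheaf.stalk x) = d at h ⊢
    induction d using WithBot.recBotCoe with
    | bot => exact bot_le
    | coe n =>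
      have h' : n < 4 := WithBot.coe_lt_coe.mp h
      have h3 : n ≤ 3 := by
        have h34 : (4 : ℕ∞) = 3 + 1 := by norm_num
        rw [h34] at h'
        exact Order.le_of_lt_add_one h'
      exact WithBot.coe_le_coe.mpr h3

end Summit.ResolutionOfSingularities.ResolutionOfSingularities.Cruxes.Picover.StubIdeas1

end
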